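import Mathlib
import HarnessLib
import Summits.MatrixMultiplication.MatrixMultiplication.Theorems.FarEdgeDescentCriterionCells

/-!
# Far-edge descent — closed criterion target for the dial β = 7/4 (model level)

Companion to `FarEdgeDescentCriterionCells` (β = 8/5, 19/10) and `FarEdgeDescentCriterionDials` (β = 39/20,
199/100): for the dial `(2, 7/4)` of `FarEdgeDescentFloorDial`,

* `Vfloor_7_4`: `1226/10000 ≤ Vfloor 2 (7/4) (99/100) 12` (`norm_num` evaluation; the value is `0.122607…`);
* `capXLD_7_4_of_criterion`: the XL-D text (all admissible schedules, all bases) for this dial follows from the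
  closed rational-parameter statement `RegionCriterion (7/4) (99/100) (1/100) (1226/10000) κ_S` — the target of a
  generated certificate `FarEdgeDescentCert74P…` (cert3.py: 127 boxes / 398 x-cells).

MODEL level; no `sorry`, no new axioms, no new definitions.
-/

noncomputable section

set_option linter.dupNamespace false

namespace Summit.MatrixMultiplication.MatrixMultiplication.Theorems.FarEdgeDescentCriterionDialB

open Real Finset
open Summit.MatrixMultiplication.MatrixMultiplication.Theorems.FarEdgeDescentFloorDial
open Summit.MatrixMultiplication.MatrixMultiplication.Theorems.FarEdgeDescentFloorDial.Sched
open Summit.MatrixMultiplication.MatrixMultiplication.Theorems.FarEdgeDescentNarrownessPotential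
open Summit.MatrixMultiplication.MatrixMultiplication.Theorems.FarEdgeDescentFloorNarrowness
open Summit.MatrixMultiplication.MatrixMultiplication.Theorems.FarEdgeDescentCriterionCells

set_option maxHeartbeats 400000 in
/-- `Vfloor 2 (7/4) (99/100) 12 ≥ 0.1226` (its value is `0.122607…`). -/
theorem Vfloor_7_4 : (1226 / 10000 : ℝ) ≤ Vfloor 2 (7 / 4) (99 / 100) 12 := by
  norm_num [Vfloor, tauP, sum_range_succ]

/-- **Target β = 7/4.**  The closed statement `RegionCriterion (7/4) (99/100) (1/100) (1226/10000) κ_S`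
implies the XL-D cap for the dial `(2, 7/4)`, all admissible schedules, all bases. -/
theorem capXLD_7_4_of_criterion
    (hcrit : RegionCriterion (7 / 4) (99 / 100) (1 / 100) (1226 / 10000)
      (Real.log (4 / 3) / Real.log 2)) :
    ∀ R : ℝ, 0 ≤ R → ∀ y₀ : ℝ → ℝ, (∀ b : ℝ, 0 ≤ b → 0 ≤ y₀ b ∧ y₀ b ≤ R / (b + 7 / 4)) →
      ∃ C : ℝ, ∀ s : Sched, Admissible 2 (7 / 4) s →
        dev (7 / 4) y₀ s ≤ C * logSize (7 / 4) s ^ (Real.log (4 / 3) / Real.log 2) :=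
  capXLD_of_regionCriterion_le 12 le_rfl (by norm_num) (by norm_num) (by norm_num) (by norm_num)
    (by norm_num) Vfloor_7_4 hcrit

end Summit.MatrixMultiplication.MatrixMultiplication.Theorems.FarEdgeDescentCriterionDialB
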